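/-
Copyright (c) 2026 the pub-hodgecm-mathlib formalisation cell (harness21).  Prover seat hodgecm-mathlib-LH7-p04 (g11), 2026-09-02∕03.
Road M6 → F3 «TOT-Λ BY OVER-ORDERS» (dealer LH4-plan (g8) WORD #75∕#76∕#77 by name), brick F3-2b, FILE 3 «(B3) MONOGENIC SUPPORT».
-/
import Literature.NumberTheory.Automorphic.SelfDualOverOrderPartition   -- ★ F3-2b FILE 2 (this seat): (A8) multiplier reading, orbit isomorphism, units; brings ★ F3-2a, ★ FILE 1 (T1)–(T3), ★ (O4-G)∕(Q)
import HarnessLib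

/-!
# The multiplier ring of a self-dual lattice is hermitian and Gorenstein («monogenic support»)

Topic `NumberTheory/Automorphic`; namespace `Literature.NumberTheory.Automorphic`.  THEOREMS ONLY (no definition, no instance, no notation, no named fact, no `sorry`).
Cell `pub/hodgecm-mathlib` (D-0151), crux H413 = `stmt-HodgeConjecture-24833`; road M6 → F3, brick **F3-2b FILE 3 = WORD #75∕#76 (B3) «MONOGENIC SUPPORT»** (sigsheet delta
`SIG-F3-2b-B3-delta.v1` 5a9da9c3b6f61ee7).  HONEST LABEL: HC_CM is proved only modulo the 2 remaining named inputs (hLiu418 24832, h413 24833) until rung 0 closes; elementary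
lattice algebra over a valuation ring, asserts nothing printed; count-neutral ((O4) is not an organ).  NO `2`, NO `d`, NO discreteness, NO `hordσ`.

FRAME = ★ FILE 2 §1 (`SelfDualOverOrderPartition`): `E` with a `ValuativeRel`, involution `σ` (`σ(𝒪) ⊆ 𝒪`), `J ∈ GL₃(𝒪)`, regular `τ` with cyclic vector `w₀`, the endoscopic carrier
`φ : E × K → M₃(E)` (`K` a field, `[K:E] = 2`, `φ` injective, `φ τ_B = τ`), adjoint `b⋆ = (σ b₁, σ_K b₂)` with `hstar : J·φ(b⋆) = σ(φ b)ᵀ·J` (NO involutivity needed); a self-dual lattice GIVEN IN A STRATUM: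
`Λ = Λ(u)` (`u ∈ U(σ,J)`) and `Λ = Λ_O(w) = span_𝒪 {φ(b)·w : b ∈ O}` for an over-order `O ∋ 𝒪` — so `O = {x : φ(x)·Λ ≤ Λ}` is the multiplier ring (★ (A8)).

THE MATHEMATICS.  §0 (any carrier `B`, abstract `⋆`): **(B3a) HERMITIAN** — if `φ(x)·Λ ≤ Λ` for a self-dual `Λ` then `φ(x⋆)·Λ ≤ Λ` (`⟨z, φ(x⋆)y⟩ = ⟨φ(x)z, y⟩` and self-duality in
membership form ★ (T2)); so multiplier rings of self-dual lattices are `⋆`-stable.  §1 (pure `K`): for a nonzero `E`-linear functional `λ` on `K` and an `E`-independent pair `a, b`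
there is a DUAL PAIR `a′, b′` (`λ(aa′) = λ(bb′) = 1`, `λ(ba′) = λ(ab′) = 0`); the `λ`-dual `{y : λ(x y) ∈ 𝒪 ∀ x ∈ span_𝒪{a,b}}` is `span_𝒪{a′,b′}`; hence **(K3) a 2-generated order
`R = span_𝒪{a,b}` of `K` is GORENSTEIN**: `R^λ = R·ν` is principal (the dual lattice `D = span{a′,b′}` has `D^λ = R`, so its multiplier ring is `R`, and ★ (Q′)
`exists_generator_quadLattice'` makes `D` principal over it).  §2: **(♠) GORENSTEIN** — `O = {y : μ(O y) ⊆ 𝒪}` for the `E`-linear functional `μ(z) = ⟨Ψv, Ψ(zv)⟩`, where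
`Λ = Ψ(O·v)` with `v ∈ (E × K)^×` (fullness) and `Ψ` the orbit isomorphism: self-duality `m ∈ Λ′ ⟺ ⟨Λ′, m⟩ ⊆ 𝒪`, `Λ′ = O v`, `⟨cv, yv⟩ = μ(c⋆y)` and `O⋆ = O` (B3a).
**(B3b) MONOGENIC** — restricting (♠) to `0 × K`: `{y ∈ K : (0, y) ∈ O} = R^{μ_K}` for `R = pr_K O`, a 2-generated order (`O ≅ Λ′` is free of rank 3; ★ (T3)), hence `= R·ν`
by (K3) (degenerate `μ_K = 0`: `O ⊇ 0 × K`, `ν = 1`): the `K`-side conductor of the multiplier ring of a self-dual lattice (F3-1a's `ker χ` of `G(N″, b, c′)`) is PRINCIPAL over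
`pr_K O = O_{N″}` — the glued order sits at a MONOGENIC LEVEL.  Left to the F3-1a-currency rider: `ker χ` principal ∧ lawful ∧ `b ≥ 1 ⇒ val(c′² − ϖ^{N″}a c′ − ϖ^{2N″}k) = b ⇒ Lvl`.

* §0 **`map_le_of_map_le_star`** (B3a).
* §1 `eq_zero_of_apply_mul_eq_zero`, `exists_dual_pair`, `setOf_forall_mem_eq_span_pair`, **`exists_setOf_forall_mem_eq_image_mul`** (K3).
* §2 `exists_linearEquiv_units_of_eq_span_image`, **`exists_coe_eq_setOf_forall_mem`** (♠), **`exists_setOf_inr_mem_eq_image`** (B3b).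

## References
* [Bass1963] H. Bass, *On the ubiquity of Gorenstein rings*, Math. Z. 82 (1963): §6–§7 (Gorenstein orders; lattices over quadratic orders are principal over their multiplier rings).
* [Jacobowitz1962] R. Jacobowitz, *Hermitian forms over local fields*, Amer. J. Math. 84 (1962): §4, §7 (dual lattices, unimodular lattices and their orders).
* [Serre1980Trees] J.-P. Serre, *Trees* (1980): Ch. II §1.1 (lattices over valuation rings).
* [HornJohnson2013] R. A. Horn, C. R. Johnson, *Matrix Analysis* (2nd ed. 2013): §3.2.4 (non-derogatory matrices and cyclic vectors).
-/

set_option autoImplicit false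

noncomputable section

open Matrix
open scoped MatrixGroups ValuativeRel Pointwise

namespace Literature.NumberTheory.Automorphic

open Literature.NumberTheory.Automorphic.UnitaryGroup

/-! ## §0 (B3a) Multiplier rings of self-dual lattices are `⋆`-stable -/

section Star

variable {E : Type*} [Field E] [ValuativeRel E] {n : ℕ} (σ : E →+* E) {B : Type*} [CommRing B] [Algebra E B]
  (hσO : ∀ x : 𝒪[E], σ x ∈ 𝒪[E]) (J : GL (Fin n) E) (hJ : J ∈ glInt n E)
  (φ : B →ₐ[E] Matrix (Fin n) (Fin n) E) (star : B →+* B) (hstar : ∀ b, (J : Matrix (Fin n) (Fin n) E) * φ (star b) = ((φ b).map σ)ᵀ * J)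

include hσO hJ hstar in
/-- **(B3a) HERMITIAN.**  If `φ(x)` stabilises a self-dual lattice `Λ = Λ(u)`, `u ∈ U(σ, J)`, then so does `φ(x⋆)`: `⟨z, φ(x⋆) y⟩ = ⟨φ(x) z, y⟩ ∈ 𝒪` for `z, y ∈ Λ`, and
`Λ = {y : ⟨Λ, y⟩ ⊆ 𝒪}` (★ (T2)).  Hence the multiplier ring of a self-dual lattice is `⋆`-stable («`c′` hermitian»). [cite: Jacobowitz1962, §4, §7] -/
theorem map_le_of_map_le_star {u : GL (Fin n) E} (hu : u ∈ unitaryGroupOfForm σ (J : Matrix (Fin n) (Fin n) E)) (x : B)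
    (hx : (Submodule.span 𝒪[E] (Set.range ((u : Matrix (Fin n) (Fin n) E))ᵀ)).map ((Matrix.toLin' (φ x)).restrictScalars 𝒪[E]) ≤
      Submodule.span 𝒪[E] (Set.range ((u : Matrix (Fin n) (Fin n) E))ᵀ)) :
    (Submodule.span 𝒪[E] (Set.range ((u : Matrix (Fin n) (Fin n) E))ᵀ)).map ((Matrix.toLin' (φ (star x))).restrictScalars 𝒪[E]) ≤
      Submodule.span 𝒪[E] (Set.range ((u : Matrix (Fin n) (Fin n) E))ᵀ) := by
  rw [Submodule.map_le_iff_le_comap]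
  intro y hy
  show φ (star x) *ᵥ y ∈ Submodule.span 𝒪[E] (Set.range ((u : Matrix (Fin n) (Fin n) E))ᵀ)
  rw [mem_span_range_transpose_iff_forall_dotProduct_mem σ hσO J hJ hu]
  intro z hz
  have h1 : dotProduct (fun i => σ ((φ x *ᵥ z) i)) ((J : Matrix (Fin n) (Fin n) E) *ᵥ y) =
      dotProduct (fun i => σ (z i)) ((J : Matrix (Fin n) (Fin n) E) *ᵥ (φ (star x) *ᵥ y)) := by
    rw [dotProduct_map_mulVec_eq, Matrix.mulVec_mulVec, Matrix.mulVec_mulVec, ← hstar x]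
  rw [← h1]
  have hxz : φ x *ᵥ z ∈ Submodule.span 𝒪[E] (Set.range ((u : Matrix (Fin n) (Fin n) E))ᵀ) := hx (Submodule.mem_map.2 ⟨z, hz, rfl⟩)
  exact (mem_span_range_transpose_iff_forall_dotProduct_mem σ hσO J hJ hu _).1 hy _ hxz

end Star

/-! ## §1 Dual pairs and the Gorenstein property of 2-generated orders of `K` -/

section DualPair

variable {E : Type*} [Field E] [ValuativeRel E] {K : Type*} [Field K] [Algebra E K] (hK2 : Module.finrank E K = 2)
  (lam : K →ₗ[E] E) (hlam : lam ≠ 0)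

include hK2 hlam in
omit [ValuativeRel E] in
/-- A nonzero `E`-linear functional `λ` on the field `K` gives a NONDEGENERATE pairing `(x, y) ↦ λ(x y)`: if `λ(a y) = λ(b y) = 0` for an `E`-basis `a, b` then `y = 0` (else `λ(K y) = λ(K) = 0`).
[cite: Bass1963, §6] -/
theorem eq_zero_of_apply_mul_eq_zero (a b : K) (hab : LinearIndependent E ![a, b]) (y : K) (ha : lam (a * y) = 0) (hb : lam (b * y) = 0) : y = 0 := by
  by_contra hy
  apply hlam
  ext z
  have htop := hab.span_eq_top_of_card_eq_finrank (by simp [hK2])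
  have hmem : z * y⁻¹ ∈ Submodule.span E (Set.range ![a, b]) := by rw [htop]; exact Submodule.mem_top
  obtain ⟨c, hc⟩ := (Submodule.mem_span_range_iff_exists_fun E).1 hmem
  rw [Fin.sum_univ_two] at hc
  simp only [Matrix.cons_val_zero, Matrix.cons_val_one] at hc
  have hz : z = (c 0 • a + c 1 • b) * y := by rw [hc, inv_mul_cancel_right₀ hy]
  rw [LinearMap.zero_apply, hz, add_mul, smul_mul_assoc, smul_mul_assoc, map_add, map_smul, map_smul, ha, hb, smul_zero, smul_zero, add_zero]

include hK2 hlam in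
omit [ValuativeRel E] in
/-- **Dual pair.**  For `λ ≠ 0` and an `E`-independent pair `a, b` of `K` (`[K:E] = 2`) there are `a′, b′` with `λ(a a′) = 1`, `λ(b a′) = 0`, `λ(a b′) = 0`, `λ(b b′) = 1` — the coordinate
map `y ↦ (λ(a y), λ(b y))` is injective, hence onto `E²`. [cite: Bass1963, §6] -/
theorem exists_dual_pair (a b : K) (hab : LinearIndependent E ![a, b]) :
    ∃ a' b' : K, lam (a * a') = 1 ∧ lam (b * a') = 0 ∧ lam (a * b') = 0 ∧ lam (b * b') = 1 := by
  haveI : Module.Finite E K := Module.finite_of_finrank_eq_succ hK2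
  let f : K →ₗ[E] (Fin 2 → E) := LinearMap.pi fun i => lam ∘ₗ LinearMap.mulLeft E (![a, b] i)
  have hf : ∀ y i, f y i = lam (![a, b] i * y) := fun y i => rfl
  have hinj : Function.Injective f := by
    rw [← LinearMap.ker_eq_bot, LinearMap.ker_eq_bot']
    intro y hy
    have h0 := congrFun hy 0
    have h1 := congrFun hy 1
    rw [hf, Pi.zero_apply] at h0 h1
    simp only [Matrix.cons_val_zero, Matrix.cons_val_one] at h0 h1
    exact eq_zero_of_apply_mul_eq_zero hK2 lam hlam a b hab y h0 h1
  have hsurj : Function.Surjective f :=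
    (LinearMap.injective_iff_surjective_of_finrank_eq_finrank (by simp [hK2])).1 hinj
  obtain ⟨a', ha'⟩ := hsurj ![1, 0]
  obtain ⟨b', hb'⟩ := hsurj ![0, 1]
  refine ⟨a', b', ?_, ?_, ?_, ?_⟩
  · have h := congrFun ha' 0; rw [hf] at h; simpa using h
  · have h := congrFun ha' 1; rw [hf] at h; simpa using h
  · have h := congrFun hb' 0; rw [hf] at h; simpa using h
  · have h := congrFun hb' 1; rw [hf] at h; simpa using h

include hK2 hlam in
/-- **The `λ`-dual of `span_𝒪{a, b}` is the dual-pair lattice `span_𝒪{a′, b′}`** (`y = λ(a y)·a′ + λ(b y)·b′`). [cite: Bass1963, §6] [cite: Serre1980Trees, Ch. II §1.1] -/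
theorem setOf_forall_mem_eq_span_pair (a b a' b' : K) (hab : LinearIndependent E ![a, b])
    (h11 : lam (a * a') = 1) (h21 : lam (b * a') = 0) (h12 : lam (a * b') = 0) (h22 : lam (b * b') = 1) :
    {y : K | ∀ x ∈ Submodule.span 𝒪[E] ({a, b} : Set K), lam (x * y) ∈ 𝒪[E]} = ↑(Submodule.span 𝒪[E] ({a', b'} : Set K)) := by
  ext y
  simp only [Set.mem_setOf_eq, SetLike.mem_coe]
  constructor
  · intro h
    have ha := h a (Submodule.subset_span (by simp))
    have hb := h b (Submodule.subset_span (by simp))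
    have hy : y = lam (a * y) • a' + lam (b * y) • b' := by
      rw [← sub_eq_zero]
      refine eq_zero_of_apply_mul_eq_zero hK2 lam hlam a b hab _ ?_ ?_
      · rw [mul_sub, map_sub, mul_add, mul_smul_comm, mul_smul_comm, map_add, map_smul, map_smul, h11, h12, smul_eq_mul, smul_eq_mul,
          mul_one, mul_zero, add_zero, sub_self]
      · rw [mul_sub, map_sub, mul_add, mul_smul_comm, mul_smul_comm, map_add, map_smul, map_smul, h21, h22, smul_eq_mul, smul_eq_mul,
          mul_zero, mul_one, zero_add, sub_self]
    rw [hy]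
    exact Submodule.mem_span_pair.2 ⟨⟨_, ha⟩, ⟨_, hb⟩, rfl⟩
  · intro h x hx
    obtain ⟨r, s, rfl⟩ := Submodule.mem_span_pair.1 h
    have hrs : (r • a' + s • b' : K) = (r : E) • a' + (s : E) • b' := rfl
    rw [hrs]
    induction hx using Submodule.span_induction with
    | mem x hx =>
      rcases hx with rfl | rfl
      · rw [mul_add, mul_smul_comm, mul_smul_comm, map_add, map_smul, map_smul, h11, h12, smul_eq_mul, mul_one, smul_eq_mul, mul_zero, add_zero]
        exact r.2
      · rw [mul_add, mul_smul_comm, mul_smul_comm, map_add, map_smul, map_smul, h21, h22, smul_eq_mul, mul_zero, smul_eq_mul, mul_one, zero_add]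
        exact s.2
    | zero => rw [zero_mul, map_zero]; exact zero_mem _
    | add x x' _ _ hx hx' => rw [add_mul, map_add]; exact add_mem hx hx'
    | smul t x _ hx =>
      change lam (((t : E) • x) * _) ∈ _
      rw [smul_mul_assoc, map_smul, smul_eq_mul]
      exact mul_mem t.2 hx

include hK2 hlam in
/-- **(K3) A 2-GENERATED ORDER OF `K` IS GORENSTEIN**: for a subring `R = span_𝒪{a, b}` of `K` (`a, b` `E`-independent) and `λ ≠ 0`, the `λ`-dual `R^λ = {y : λ(R y) ⊆ 𝒪}` is
PRINCIPAL, `R^λ = R·ν`.  (The dual lattice `D = span{a′, b′}` satisfies `D^λ = R`, so its multiplier ring lies in `R`; ★ (Q′) `exists_generator_quadLattice'` — via ★ (T3)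
`exists_sq_eq_of_linearIndependent` — makes `D` principal over its multiplier ring; and `R·D ⊆ D`.) [cite: Bass1963, §7] [cite: Jacobowitz1962, §7] -/
theorem exists_setOf_forall_mem_eq_image_mul (R : Subring K) (a b : K) (hab : LinearIndependent E ![a, b])
    (hR : (R : Set K) = ↑(Submodule.span 𝒪[E] ({a, b} : Set K))) :
    ∃ ν : K, {y : K | ∀ x ∈ R, lam (x * y) ∈ 𝒪[E]} = (fun x => x * ν) '' (R : Set K) := by
  obtain ⟨a', b', h11, h21, h12, h22⟩ := exists_dual_pair hK2 lam hlam a b hab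
  have hab' : LinearIndependent E ![a', b'] := by
    rw [LinearIndependent.pair_iff]
    intro s t hst
    have h1 := congrArg (fun z => lam (a * z)) hst
    have h2 := congrArg (fun z => lam (b * z)) hst
    simp only [mul_add, mul_smul_comm, map_add, map_smul, h11, h12, h21, h22, mul_zero, map_zero, smul_eq_mul, mul_one, add_zero,
      zero_add] at h1 h2
    exact ⟨h1, h2⟩
  have hRmem : ∀ x, x ∈ R ↔ x ∈ Submodule.span 𝒪[E] ({a, b} : Set K) := fun x => by
    rw [← SetLike.mem_coe, hR, SetLike.mem_coe]
  -- the dual lattice `D = span{a′, b′}` and its dual `R`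
  have hD := setOf_forall_mem_eq_span_pair hK2 lam hlam a b a' b' hab h11 h21 h12 h22
  have hD' := setOf_forall_mem_eq_span_pair hK2 lam hlam a' b' a b hab'
    (by rw [mul_comm, h11]) (by rw [mul_comm, h12]) (by rw [mul_comm, h21]) (by rw [mul_comm, h22])
  have hRD : ∀ y, (∀ x ∈ R, lam (x * y) ∈ 𝒪[E]) ↔ y ∈ Submodule.span 𝒪[E] ({a', b'} : Set K) := by
    intro y
    have h := Set.ext_iff.1 hD y
    simp only [Set.mem_setOf_eq, SetLike.mem_coe] at h
    rw [← h]
    exact ⟨fun h' x hx => h' x ((hRmem x).2 hx), fun h' x hx => h' x ((hRmem x).1 hx)⟩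
  have hD'mem : ∀ x, (∀ y ∈ Submodule.span 𝒪[E] ({a', b'} : Set K), lam (y * x) ∈ 𝒪[E]) ↔ x ∈ R := by
    intro x
    have h := Set.ext_iff.1 hD' x
    simp only [Set.mem_setOf_eq, SetLike.mem_coe] at h
    rw [h, hRmem]
  -- ★ (Q′): `D` is principal over its multiplier ring
  obtain ⟨s, m, hsm⟩ := exists_sq_eq_of_linearIndependent hK2 a' b' hab'
  obtain ⟨ν, hνD, hgen⟩ := exists_generator_quadLattice' a' b' (hab'.ne_zero 0) s m hsm hab'
  refine ⟨ν, Set.ext fun y => ?_⟩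
  simp only [Set.mem_setOf_eq, Set.mem_image, SetLike.mem_coe]
  rw [hRD]
  constructor
  · intro hy
    obtain ⟨c, hcD, rfl⟩ := hgen y hy
    refine ⟨c, ?_, rfl⟩
    refine (hD'mem c).1 fun y' hy' => ?_
    have hcy' : c * y' ∈ Submodule.span 𝒪[E] ({a', b'} : Set K) := (pointwise_smul_le_iff_forall _ _ _).1 hcD y' hy'
    have h1 := (hRD (c * y')).2 hcy' 1 R.one_mem
    rwa [one_mul, mul_comm] at h1
  · rintro ⟨x, hx, rfl⟩
    refine (hRD (x * ν)).1 fun x' hx' => ?_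
    rw [← mul_assoc]
    exact (hRD ν).2 hνD (x' * x) (R.mul_mem hx' hx)

end DualPair

/-! ## §2 (♠) Gorenstein and (B3b) monogenic support for the multiplier ring of a self-dual lattice -/

section Endoscopic

variable {E : Type*} [Field E] [ValuativeRel E] (σ : E →+* E) {K : Type*} [Field K] [Algebra E K] (σK : K →+* K)
  (hσO : ∀ x : 𝒪[E], σ x ∈ 𝒪[E]) (hK2 : Module.finrank E K = 2)
  (J : GL (Fin 3) E) (hJ : J ∈ glInt 3 E)
  (τ : Matrix (Fin 3) (Fin 3) E) {w₀ : Fin 3 → E} (hK : IsUnit (Matrix.of fun i j : Fin 3 => ((τ ^ (j : ℕ)) *ᵥ w₀) i).det)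
  (φ : (E × K) →ₐ[E] Matrix (Fin 3) (Fin 3) E) (hφ : Function.Injective φ) (τB : E × K) (hτB : φ τB = τ)
  (hstar : ∀ b : E × K, (J : Matrix (Fin 3) (Fin 3) E) * φ (RingHom.prodMap σ σK b) = ((φ b).map σ)ᵀ * J)
  (O : Subring (E × K)) (hO : ∀ r : 𝒪[E], algebraMap E (E × K) (r : E) ∈ O)

include hK hφ hτB hO in
/-- **A full `O`-cyclic lattice is `Ψ(O·v)` for a unit `v`.**  If `Λ = Λ(g) = Λ_O(w)` then, with the orbit isomorphism `Ψ` (★ `exists_linearEquiv_eq_mulVec`), `w = Ψ v` for a unit `v`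
(★ `isUnit_of_surjective_mulVec`) and `c ∈ O ⟺ Ψ(c v) ∈ Λ` (★ F3-2a `mem_span_image_mulVec_iff` + cancellation of the unit). [cite: Serre1980Trees, Ch. II §1.1] -/
theorem exists_linearEquiv_units_of_eq_span_image {Λ : Submodule 𝒪[E] (Fin 3 → E)}
    (hfull : ∃ g : GL (Fin 3) E, Λ = Submodule.span 𝒪[E] (Set.range ((g : Matrix (Fin 3) (Fin 3) E))ᵀ))
    (w : Fin 3 → E) (hw : Λ = Submodule.span 𝒪[E] ((fun b : E × K => φ b *ᵥ w) '' (O : Set (E × K)))) :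
    ∃ Ψ : (E × K) ≃ₗ[E] (Fin 3 → E), (∀ b, Ψ b = φ b *ᵥ w₀) ∧
      ∃ v : (E × K)ˣ, Ψ (v : E × K) = w ∧ ∀ c : E × K, c ∈ O ↔ Ψ (c * v) ∈ Λ := by
  obtain ⟨Ψ, hΨ⟩ := exists_linearEquiv_eq_mulVec τ hK φ hφ τB hτB
  obtain ⟨g, rfl⟩ := hfull
  have hΨmul : ∀ b m : E × K, Ψ (b * m) = φ b *ᵥ Ψ m := fun b m => by rw [hΨ, hΨ, map_mul, Matrix.mulVec_mulVec]
  obtain ⟨a, rfl⟩ : ∃ a, Ψ a = w := ⟨Ψ.symm w, Ψ.apply_symm_apply w⟩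
  -- `a` is a unit: `φ(a)` is onto (its range contains the columns of `g`)
  have hsurj : Function.Surjective (φ a).mulVec := by
    have hr : LinearMap.range (Matrix.toLin' (φ a)) = ⊤ := by
      rw [eq_top_iff, ← span_range_transpose_eq_top g, Submodule.span_le]
      rintro _ ⟨j, rfl⟩
      have hj : ((g : Matrix (Fin 3) (Fin 3) E))ᵀ j ∈ Submodule.span 𝒪[E] ((fun b : E × K => φ b *ᵥ Ψ a) '' (O : Set (E × K))) := by
        rw [← hw]; exact Submodule.subset_span ⟨j, rfl⟩
      obtain ⟨b, -, hb⟩ := (mem_span_image_mulVec_iff φ O hO _ _).1 hj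
      refine ⟨φ b *ᵥ w₀, ?_⟩
      rw [Matrix.toLin'_apply, ← hb, hΨ, Matrix.mulVec_mulVec, Matrix.mulVec_mulVec, ← map_mul, ← map_mul, mul_comm]
    exact LinearMap.range_eq_top.1 hr
  obtain ⟨v, hv⟩ := isUnit_of_surjective_mulVec φ hφ a hsurj
  refine ⟨Ψ, hΨ, v, by rw [hv], fun c => ?_⟩
  rw [hv, hw, mem_span_image_mulVec_iff φ O hO]
  constructor
  · intro hc
    exact ⟨c, hc, by rw [hΨmul]⟩
  · rintro ⟨c', hc', h⟩
    rw [← hΨmul] at h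
    have h' : c' * a = c * a := Ψ.injective h
    rw [← hv, Units.mul_left_inj] at h'
    rw [← h']; exact hc'

include hσO hJ hK hφ hτB hstar hO in
/-- **(♠) THE MULTIPLIER RING OF A SELF-DUAL LATTICE IS GORENSTEIN**: for `Λ = Λ(u) = Λ_O(w)` (`u ∈ U(σ,J)`) there is an `E`-linear functional `μ` on `E × K` with
`O = {y : μ(c y) ∈ 𝒪 for all c ∈ O}` — `O` is its own `μ`-dual.  (`Λ = Ψ(O v)`, `μ(z) = ⟨Ψ v, Ψ(z v)⟩`; `y ∈ O ⟺ y v ∈ Λ′ ⟺ ⟨O v, y v⟩ ⊆ 𝒪 ⟺ μ(O⋆ y) ⊆ 𝒪`, and `O⋆ = O`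
by (B3a).) [cite: Bass1963, §6–§7] [cite: Jacobowitz1962, §7] -/
theorem exists_coe_eq_setOf_forall_mem {Λ : Submodule 𝒪[E] (Fin 3 → E)}
    (hsd : ∃ u ∈ unitaryGroupOfForm σ (J : Matrix (Fin 3) (Fin 3) E), Λ = Submodule.span 𝒪[E] (Set.range ((u : Matrix (Fin 3) (Fin 3) E))ᵀ))
    (w : Fin 3 → E) (hw : Λ = Submodule.span 𝒪[E] ((fun b : E × K => φ b *ᵥ w) '' (O : Set (E × K)))) :
    ∃ μ : (E × K) →ₗ[E] E, (O : Set (E × K)) = {y | ∀ c ∈ O, μ (c * y) ∈ 𝒪[E]} := by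
  obtain ⟨u, hu, rfl⟩ := hsd
  obtain ⟨Ψ, hΨ, v, hvw, hOiff⟩ := exists_linearEquiv_units_of_eq_span_image τ hK φ hφ τB hτB O hO ⟨u, rfl⟩ w hw
  have hΨmul : ∀ b m : E × K, Ψ (b * m) = φ b *ᵥ Ψ m := fun b m => by rw [hΨ, hΨ, map_mul, Matrix.mulVec_mulVec]
  -- `O⋆ = O` ((B3a), through the multiplier reading ★ (A8))
  have hA8 := setOf_map_le_span_image_eq_of_eq_span_range τ hK φ hφ τB hτB O hO w u hw.symm
  have hOstar : ∀ c ∈ O, RingHom.prodMap σ σK c ∈ O := by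
    intro c hc
    have hc' := (Set.ext_iff.1 hA8 c).2 hc
    have h2 := (Set.ext_iff.1 hA8 (RingHom.prodMap σ σK c)).1
    simp only [Set.mem_setOf_eq, SetLike.mem_coe] at hc' h2
    apply h2
    rw [← hw] at hc' ⊢
    exact map_le_of_map_le_star σ hσO J hJ φ (RingHom.prodMap σ σK) hstar hu c hc'
  -- the pairing `P` and its adjoint
  set P : E × K → E × K → E := fun m m' => dotProduct (fun i => σ (Ψ m i)) ((J : Matrix (Fin 3) (Fin 3) E) *ᵥ Ψ m') with hPdef
  have hadj : ∀ b m m', P (b * m) m' = P m (RingHom.prodMap σ σK b * m') := by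
    intro b m m'
    simp only [hPdef]
    rw [hΨmul b m, hΨmul (RingHom.prodMap σ σK b) m', dotProduct_map_mulVec_eq, Matrix.mulVec_mulVec, Matrix.mulVec_mulVec, ← hstar b]
  let μ : (E × K) →ₗ[E] E :=
    { toFun := fun z => P (v : E × K) (z * v),
      map_add' := fun z z' => by simp only [hPdef, add_mul, map_add, Matrix.mulVec_add, dotProduct_add],
      map_smul' := fun e z => by
        simp only [hPdef, smul_mul_assoc, map_smul, Matrix.mulVec_smul, dotProduct_smul, smul_eq_mul, RingHom.id_apply] }
  have hμ : ∀ z, μ z = P (v : E × K) (z * v) := fun z => rfl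
  refine ⟨μ, ?_⟩
  ext y
  simp only [SetLike.mem_coe, Set.mem_setOf_eq, hμ]
  have hv1 : Ψ (v : E × K) ∈ Submodule.span 𝒪[E] (Set.range ((u : Matrix (Fin 3) (Fin 3) E))ᵀ) := by
    have h1 := (hOiff 1).1 O.one_mem; rwa [one_mul] at h1
  constructor
  · intro hy c hc
    have hcy : Ψ (c * y * (v : E × K)) ∈ Submodule.span 𝒪[E] (Set.range ((u : Matrix (Fin 3) (Fin 3) E))ᵀ) := (hOiff _).1 (O.mul_mem hc hy)
    exact (mem_span_range_transpose_iff_forall_dotProduct_mem σ hσO J hJ hu _).1 hcy _ hv1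
  · intro h
    rw [hOiff, mem_span_range_transpose_iff_forall_dotProduct_mem σ hσO J hJ hu]
    intro y' hy'
    rw [hw] at hy'
    obtain ⟨c, hc, rfl⟩ := (mem_span_image_mulVec_iff φ O hO _ _).1 hy'
    rw [← hvw, ← hΨmul]
    have h1 : dotProduct (fun i => σ (Ψ (c * (v : E × K)) i)) ((J : Matrix (Fin 3) (Fin 3) E) *ᵥ Ψ (y * v)) =
        P (v : E × K) (RingHom.prodMap σ σK c * y * v) := by
      show P (c * v) (y * v) = _
      rw [hadj, mul_assoc]
    rw [h1]
    exact h _ (hOstar c hc)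

include hσO hK2 hJ hK hφ hτB hstar hO in
/-- **(B3b) MONOGENIC SUPPORT.**  For a self-dual lattice in the stratum of `O` (`Λ = Λ(u) = Λ_O(w)`), the `K`-side conductor of its multiplier ring is PRINCIPAL over `pr_K O`:
`{y ∈ K : (0, y) ∈ O} = (pr_K O)·ν`.  (Restrict (♠) to `0 × K`: the left side is the `μ_K`-dual of the order `R = pr_K O`, which is 2-generated (`O ≅ Λ′` is free of rank 3,
★ (T3)); (K3); if `μ_K = 0` then `O ⊇ 0 × K` and `ν = 1`.)  In F3-1a's currency: the glued order `G(N″, b, c′) = O(Λ)` has `ker χ = ν·O_{N″}` — a MONOGENIC level.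
[cite: Bass1963, §7] [cite: Jacobowitz1962, §7] [cite: Serre1980Trees, Ch. II §1.1] -/
theorem exists_setOf_inr_mem_eq_image {Λ : Submodule 𝒪[E] (Fin 3 → E)}
    (hsd : ∃ u ∈ unitaryGroupOfForm σ (J : Matrix (Fin 3) (Fin 3) E), Λ = Submodule.span 𝒪[E] (Set.range ((u : Matrix (Fin 3) (Fin 3) E))ᵀ))
    (w : Fin 3 → E) (hw : Λ = Submodule.span 𝒪[E] ((fun b : E × K => φ b *ᵥ w) '' (O : Set (E × K)))) :
    ∃ ν : K, {y : K | ((0 : E), y) ∈ O} = (fun c : E × K => c.2 * ν) '' (O : Set (E × K)) := by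
  obtain ⟨μ, hμ⟩ := exists_coe_eq_setOf_forall_mem σ σK hσO J hJ τ hK φ hφ τB hτB hstar O hO hsd w hw
  obtain ⟨u, hu, rfl⟩ := hsd
  obtain ⟨Ψ, hΨ, v, hvw, hOiff⟩ := exists_linearEquiv_units_of_eq_span_image τ hK φ hφ τB hτB O hO ⟨u, rfl⟩ w hw
  have hOμ : ∀ y, y ∈ O ↔ ∀ c ∈ O, μ (c * y) ∈ 𝒪[E] := fun y => by
    have h := Set.ext_iff.1 hμ y
    simpa only [SetLike.mem_coe, Set.mem_setOf_eq] using h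
  -- the order `R = pr_K O` and the functional `μ_K = μ ∘ inr`
  set R : Subring K := O.map (RingHom.snd E K) with hRdef
  have hRmem : ∀ x, x ∈ R ↔ ∃ c ∈ O, c.2 = x := fun x => by rw [hRdef, Subring.mem_map]; rfl
  set μK : K →ₗ[E] E := μ ∘ₗ LinearMap.inr E E K with hμKdef
  have hmul0 : ∀ (c : E × K) (y : K), c * ((0 : E), y) = ((0 : E), c.2 * y) := fun c y => by ext <;> simp
  have hJK : ∀ y : K, ((0 : E), y) ∈ O ↔ ∀ x ∈ R, μK (x * y) ∈ 𝒪[E] := by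
    intro y
    rw [hOμ]
    constructor
    · intro h x hx
      obtain ⟨c, hc, rfl⟩ := (hRmem x).1 hx
      have h1 := h c hc
      rw [hmul0] at h1
      exact h1
    · intro h c hc
      rw [hmul0]
      exact h c.2 ((hRmem _).2 ⟨c, hc, rfl⟩)
  -- `Λ′ = Ψ⁻¹ Λ` is spanned by the three pulled-back columns; `O = Λ′ · v⁻¹`
  set Λ' : Submodule 𝒪[E] (E × K) :=
    (Submodule.span 𝒪[E] (Set.range ((u : Matrix (Fin 3) (Fin 3) E))ᵀ)).comap
      ((Ψ.restrictScalars 𝒪[E] : (E × K) ≃ₗ[𝒪[E]] (Fin 3 → E)) : (E × K) →ₗ[𝒪[E]] (Fin 3 → E)) with hΛ'def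
  have hmem : ∀ m, m ∈ Λ' ↔ Ψ m ∈ Submodule.span 𝒪[E] (Set.range ((u : Matrix (Fin 3) (Fin 3) E))ᵀ) := fun m => Iff.rfl
  have hΛ'map : Λ' = (Submodule.span 𝒪[E] (Set.range ((u : Matrix (Fin 3) (Fin 3) E))ᵀ)).map
      ((Ψ.restrictScalars 𝒪[E]).symm : (Fin 3 → E) →ₗ[𝒪[E]] (E × K)) := by
    rw [hΛ'def]; exact Submodule.comap_equiv_eq_map_symm _ _
  set z : Fin 3 → E × K := fun j => (Ψ.restrictScalars 𝒪[E]).symm (((u : Matrix (Fin 3) (Fin 3) E))ᵀ j) with hzdef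
  have hΛ'span : Λ' = Submodule.span 𝒪[E] (Set.range z) := by
    rw [hΛ'map, Submodule.map_span, ← Set.range_comp]; rfl
  set x' : Fin 3 → K := fun j => (z j * ((v⁻¹ : (E × K)ˣ) : E × K)).2 with hx'def
  have hR : (R : Set K) = ↑(Submodule.span 𝒪[E] (Set.range x')) := by
    have hg : Submodule.span 𝒪[E] (Set.range x') =
        Λ'.map (((LinearMap.snd E E K).comp (LinearMap.mulRight E ((v⁻¹ : (E × K)ˣ) : E × K))).restrictScalars 𝒪[E]) := by
      rw [hΛ'span, Submodule.map_span, ← Set.range_comp]; rfl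
    ext x
    rw [SetLike.mem_coe, SetLike.mem_coe, hRmem, hg, Submodule.mem_map]
    constructor
    · rintro ⟨c, hc, rfl⟩
      refine ⟨c * v, (hmem _).2 ((hOiff c).1 hc), ?_⟩
      simp only [LinearMap.coe_restrictScalars, LinearMap.coe_comp, Function.comp_apply, LinearMap.mulRight_apply, LinearMap.snd_apply,
        Units.mul_inv_cancel_right]
    · rintro ⟨m, hm, rfl⟩
      refine ⟨m * ((v⁻¹ : (E × K)ˣ) : E × K), (hOiff _).2 ?_, rfl⟩
      rw [Units.inv_mul_cancel_right]; exact (hmem m).1 hm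
  have hx'top : Submodule.span E (Set.range x') = ⊤ := by
    have h1 : Submodule.span E (Set.range z) = ⊤ := by
      have h : Submodule.span E (Set.range z) =
          (Submodule.span E (Set.range ((u : Matrix (Fin 3) (Fin 3) E))ᵀ)).map (Ψ.symm : (Fin 3 → E) →ₗ[E] (E × K)) := by
        rw [Submodule.map_span, ← Set.range_comp]; rfl
      rw [h, span_range_transpose_eq_top, Submodule.map_top, LinearMap.range_eq_top]
      exact Ψ.symm.surjective
    have h2 : Submodule.span E (Set.range x') =
        (Submodule.span E (Set.range z)).map ((LinearMap.snd E E K).comp (LinearMap.mulRight E ((v⁻¹ : (E × K)ˣ) : E × K))) := by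
      rw [Submodule.map_span, ← Set.range_comp]; rfl
    rw [h2, h1, Submodule.map_top, LinearMap.range_eq_top]
    intro y
    refine ⟨((0 : E), y) * (v : E × K), ?_⟩
    simp only [LinearMap.coe_comp, Function.comp_apply, LinearMap.mulRight_apply, LinearMap.snd_apply, Units.mul_inv_cancel_right]
  obtain ⟨α', β', hαβ, hspan⟩ := exists_span_range_eq_span_pair hK2 x' hx'top
  have hR' : (R : Set K) = ↑(Submodule.span 𝒪[E] ({α', β'} : Set K)) := by rw [hR, hspan]
  by_cases hμK0 : μK = 0
  · -- degenerate: `O ⊇ 0 × K`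
    refine ⟨1, Set.ext fun y => ?_⟩
    simp only [Set.mem_setOf_eq, Set.mem_image, SetLike.mem_coe, mul_one]
    constructor
    · intro hy
      exact ⟨((0 : E), y), hy, rfl⟩
    · rintro ⟨c, hc, rfl⟩
      rw [hJK]
      intro x _
      rw [hμK0, LinearMap.zero_apply]
      exact zero_mem _
  · obtain ⟨ν, hν⟩ := exists_setOf_forall_mem_eq_image_mul hK2 μK hμK0 R α' β' hαβ hR'
    refine ⟨ν, ?_⟩
    have h2 : (fun c : E × K => c.2 * ν) '' (O : Set (E × K)) = (fun x => x * ν) '' (R : Set K) := by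
      rw [hRdef, Subring.coe_map, Set.image_image]; rfl
    rw [h2, ← hν]
    ext y
    simp only [Set.mem_setOf_eq]
    exact hJK y

end Endoscopic

end Literature.NumberTheory.Automorphic

end
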